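import Summits.CriticalPhenomena.PercolationContinuityZ3.Theorems.Transplant.FKConnectivityAllQAntipodalRootFormPair
import Summits.CriticalPhenomena.PercolationContinuityZ3.Theorems.Transplant.FKConnectivityAllQAntipodalRootFormEnvAnd
import Summits.CriticalPhenomena.PercolationContinuityZ3.Theorems.Transplant.FKConnectivityAllQAntipodalRootFormLetters
import Summits.CriticalPhenomena.PercolationContinuityZ3.Theorems.Transplant.FKConnectivityAllQAntipodalRootFormParBox
import HarnessLib

/-!
# Connectivity correlation inequalities for `φ_{w,q}`, every `q > 0` — ROOT-FORM CALCULUS, file 61s: SPINE CELLS and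
# **the `q`-free `maj₃` inequality on every spine host `x ∥ ℓ₁(ℓ₂(⋯ℓ_m(B_y ∥ B_z)⋯))`** (the word theorem ★(Θ) for all words and all boxes)

Support file (`--supports stmt-CriticalPhenomena-4575`), FK sub-lane `prim-bschramm-fk-2` (gen 29); builds on p205010 (kernel theorem,
internal audit signed; external expert review pending).  One definition (`IsSpineCell`), no named facts, no sorries; standard axioms.  Memo
FROM-fk-2-g28-ROOT-FORM.md §4 (iii), §7 (L4d); FK-Q2 §38.

`IsSpineCell y z M C a b`: the cell `(M, C)` with poles `a, b` of a SPINE ENVIRONMENT — a theta pair `B_y ∥ B_z` of two-terminal series–parallel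
boxes carrying the special edges `y, z` (cells `M_y, C_y`, `M_z, C_z`), followed by any word of letters: a fresh free edge in series at a pole
(new pole = its far end) or a new free edge between the poles.  `isSpineCell_facts`: the five facts of the word theorem hold for the real
environment of every spine cell (base: THEOREM G27 for real boxes + `parBox` + the three real AND facts, transferred along `(β_y, β_z) ↦ β_y ∪ β_z`;
letters: files 61a/61b transferred by file 61r).  **`maj3_levels_le_nonpos_of_isSpineCell`**: for every spine cell and the root `x = ab` off the
cell, every increasing `g` blind to `x, y, z` and every `J`, the level-`J` partial sum of the antipodal form of `maj₃(ω_x,ω_y,ω_z)` against `g`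
is `≤ 0` — every coefficient in `z` and `q` of `Z_H(z,q)² Cov_{φ_{z,q}}(maj₃, g)/(q−1)` is nonnegative on the hosts `Θ(W; B_y, B_z)` of the memos,
for EVERY spine word `W` and ALL boxes (root identity, file 61n).
[cite: Grimmett2006, §1.4 eq. (1.20) (p. 15); §3.8 Thm. (3.90) (pp. 61–62)] [cite: Wagner2006, Thm. 5.8(d), §5.3]
-/

noncomputable section

namespace Summit.CriticalPhenomena.PercolationContinuityZ3.Theorems

namespace FK

namespace RootForm

open SimpleGraph Finset Literature.Probability.LatticeModels Literature.Probability.Percolation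
open scoped Classical

variable {V : Type*} [Fintype V]

/-- **Spine cells.**  `IsSpineCell y z M C a b`: `(M, C)` (free / contracted edges) with poles `a, b` is the cell of a spine environment over
the special edges `y, z`: either the cell `(M_y ∪ M_z, C_y ∪ C_z)` of a theta pair `B_y ∥ B_z` (two-terminal series–parallel boxes between
common poles `c, d`, edge-disjoint, vertex sets meeting only in the poles, `y ∈ B_y`, `z ∈ B_z`, cells inside `B_y \ y`, `B_z \ z`), or obtained
from a spine cell by a SERIES letter (a free edge `a m` from a fresh vertex `a` to the pole `m`; poles become `a, b`) or a PARALLEL letter (a new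
free edge `a b` between the poles). (memo FROM-fk-2-g28-ROOT-FORM §1, §4(iii)) -/
inductive IsSpineCell (y z : Sym2 V) : Finset (Sym2 V) → Finset (Sym2 V) → V → V → Prop
  /-- the theta pair `B_y ∥ B_z` -/
  | base {B B' : Finset (Sym2 V)} {c d uy vy uz vz : V} {My Cy Mz Cz : Finset (Sym2 V)}
      (hB : IsTTSP B c d) (hB' : IsTTSP B' c d) (hd : Disjoint B B')
      (hV : ∀ w : V, (∃ e ∈ B, w ∈ e) → (∃ e ∈ B', w ∈ e) → w = c ∨ w = d)
      (hy : y = s(uy, vy)) (hz : z = s(uz, vz)) (hyB : s(uy, vy) ∈ B) (hzB : s(uz, vz) ∈ B')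
      (hMy : My ⊆ B.erase s(uy, vy)) (hCy : Cy ⊆ B.erase s(uy, vy)) (hMz : Mz ⊆ B'.erase s(uz, vz)) (hCz : Cz ⊆ B'.erase s(uz, vz))
      (hMCy : Disjoint My Cy) (hMCz : Disjoint Mz Cz) :
      IsSpineCell y z (My ∪ Mz) (Cy ∪ Cz) c d
  /-- a series letter: fresh vertex `a`, free edge `a m` at the pole `m` -/
  | ser {M C : Finset (Sym2 V)} {a m b : V} (h : IsSpineCell y z M C m b) (ha : ∀ e ∈ insert y (insert z (M ∪ C)), a ∉ e)
      (hab : a ≠ b) (ham : a ≠ m) : IsSpineCell y z (insert s(a, m) M) C a b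
  /-- a parallel letter: new free edge `a b` between the poles -/
  | par {M C : Finset (Sym2 V)} {a b : V} (h : IsSpineCell y z M C a b) (hg : s(a, b) ∉ insert y (insert z (M ∪ C))) (hab : a ≠ b) :
      IsSpineCell y z (insert s(a, b) M) C a b

section Base

variable {B B' : Finset (Sym2 V)} {c d uy vy uz vz : V} {My Cy Mz Cz : Finset (Sym2 V)}

/-- flipping a level shift. [folklore] -/
theorem PDat.eq_of_addLam {A B : PDat} {κ : ℤ} (h : A = ⟨B.lam + κ, B.k1, B.k2⟩) : B = ⟨A.lam + (-κ), A.k1, A.k2⟩ := by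
  obtain ⟨l, k1, k2⟩ := B; rw [h]; simp

/-- **The five facts for the real environment of a theta pair** `B_y ∥ B_z` (cells disjoint). [cite: Grimmett2006, §3.8 Thm. (3.90) (pp. 61–62)]
[cite: Wagner2006, Thm. 5.8(d), §5.3] -/
theorem realPairEnv_facts (hB : IsTTSP B c d) (hB' : IsTTSP B' c d) (hd : Disjoint B B')
    (hV : ∀ w : V, (∃ e ∈ B, w ∈ e) → (∃ e ∈ B', w ∈ e) → w = c ∨ w = d) (hy : s(uy, vy) ∈ B) (hz : s(uz, vz) ∈ B')
    (hMy : My ⊆ B.erase s(uy, vy)) (hCy : Cy ⊆ B.erase s(uy, vy)) (hMz : Mz ⊆ B'.erase s(uz, vz)) (hCz : Cz ⊆ B'.erase s(uz, vz))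
    (hMCy : Disjoint My Cy) (hMCz : Disjoint Mz Cz) :
    (∀ h0 h1 : ↥(My ∪ Mz).powerset → ℝ, Monotone h0 → Monotone h1 → (∀ γ, 0 ≤ h0 γ) → (∀ γ, h0 γ ≤ h1 γ) → ∀ J : ℤ,
        0 ≤ Mt (realEnv (My ∪ Mz) (Cy ∪ Cz) c d s(uy, vy) s(uz, vz)) h0 h1 J)
      ∧ (∀ h0 h1 : Bool × ↥(My ∪ Mz).powerset → ℝ, Monotone h0 → Monotone h1 → (∀ p, 0 ≤ h0 p) → (∀ p, h0 p ≤ h1 p) → ∀ J : ℤ,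
        0 ≤ Mt (parE (realEnv (My ∪ Mz) (Cy ∪ Cz) c d s(uy, vy) s(uz, vz))) h0 h1 J)
      ∧ (∀ h : ↥(My ∪ Mz).powerset → ℝ, Monotone h → (∀ γ, 0 ≤ h γ) → ∀ J : ℤ,
        0 ≤ ∑ γ, h γ * (realEnv (My ∪ Mz) (Cy ∪ Cz) c d s(uy, vy) s(uz, vz) γ).andDel J)
      ∧ (∀ h : ↥(My ∪ Mz).powerset → ℝ, Monotone h → (∀ γ, 0 ≤ h γ) → ∀ J : ℤ,
        0 ≤ ∑ γ, h γ * (realEnv (My ∪ Mz) (Cy ∪ Cz) c d s(uy, vy) s(uz, vz) γ).andCon J)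
      ∧ (∀ h0 h1 : ↥(My ∪ Mz).powerset → ℝ, Monotone h0 → Monotone h1 → (∀ γ, 0 ≤ h0 γ) → (∀ γ, h0 γ ≤ h1 γ) → ∀ J : ℤ,
          0 ≤ ∑ γ, (h1 γ * (realEnv (My ∪ Mz) (Cy ∪ Cz) c d s(uy, vy) s(uz, vz) γ).andE1 J +
            h0 γ * (realEnv (My ∪ Mz) (Cy ∪ Cz) c d s(uy, vy) s(uz, vz) γ).andE2 J)) := by
  have hMyB : My ⊆ B := hMy.trans (Finset.erase_subset _ _)
  have hMzB : Mz ⊆ B' := hMz.trans (Finset.erase_subset _ _)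
  have hCyB : Cy ⊆ B := hCy.trans (Finset.erase_subset _ _)
  have hCzB : Cz ⊆ B' := hCz.trans (Finset.erase_subset _ _)
  have hdM : Disjoint My Mz := Finset.disjoint_of_subset_left hMyB (Finset.disjoint_of_subset_right hMzB hd)
  have hyM : s(uy, vy) ∉ My := fun h => (Finset.mem_erase.1 (hMy h)).1 rfl
  have hzM : s(uz, vz) ∉ Mz := fun h => (Finset.mem_erase.1 (hMz h)).1 rfl
  have hyB' : s(uy, vy) ∉ B' := Finset.disjoint_left.1 hd hy
  have hzB : s(uz, vz) ∉ B := Finset.disjoint_right.1 hd hz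
  have hyz : s(uy, vy) ≠ s(uz, vz) := fun h => hyB' (h ▸ hz)
  -- the glued host and its cell
  have hF : IsTTSP (B ∪ B') c d := IsTTSP.parallel hB hB' hd hV
  have hyF : s(uy, vy) ∈ B ∪ B' := Finset.mem_union_left _ hy
  have hzF : s(uz, vz) ∈ B ∪ B' := Finset.mem_union_right _ hz
  have hME : My ∪ Mz ⊆ ((B ∪ B').erase s(uy, vy)).erase s(uz, vz) := fun e he => by
    rcases Finset.mem_union.1 he with h | h
    · exact Finset.mem_erase.2 ⟨fun h' => hzB (h' ▸ hMyB h), Finset.mem_erase.2 ⟨fun h' => hyM (h' ▸ h), Finset.mem_union_left _ (hMyB h)⟩⟩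
    · exact Finset.mem_erase.2 ⟨fun h' => hzM (h' ▸ h), Finset.mem_erase.2 ⟨fun h' => hyB' (h' ▸ hMzB h), Finset.mem_union_right _ (hMzB h)⟩⟩
  have hCE : Cy ∪ Cz ⊆ ((B ∪ B').erase s(uy, vy)).erase s(uz, vz) := fun e he => by
    rcases Finset.mem_union.1 he with h | h
    · exact Finset.mem_erase.2 ⟨fun h' => hzB (h' ▸ hCyB h), Finset.mem_erase.2
        ⟨fun h' => (Finset.mem_erase.1 (hCy h)).1 h', Finset.mem_union_left _ (hCyB h)⟩⟩
    · exact Finset.mem_erase.2 ⟨fun h' => (Finset.mem_erase.1 (hCz h)).1 h', Finset.mem_erase.2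
        ⟨fun h' => hyB' (h' ▸ hCzB h), Finset.mem_union_right _ (hCzB h)⟩⟩
  have hMC : Disjoint (My ∪ Mz) (Cy ∪ Cz) := by
    rw [Finset.disjoint_union_left, Finset.disjoint_union_right, Finset.disjoint_union_right]
    exact ⟨⟨hMCy, Finset.disjoint_of_subset_left hMyB (Finset.disjoint_of_subset_right hCzB hd)⟩,
      ⟨Finset.disjoint_of_subset_left hMzB (Finset.disjoint_of_subset_right hCyB hd.symm), hMCz⟩⟩
  -- the union equivalence and the transfer from the abstract pair
  let φ : ↥My.powerset × ↥Mz.powerset ≃ ↥(My ∪ Mz).powerset :=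
    { toFun := fun p => ⟨p.1.1 ∪ p.2.1, Finset.mem_powerset.2
        (Finset.union_subset_union (Finset.mem_powerset.1 p.1.2) (Finset.mem_powerset.1 p.2.2))⟩
      invFun := fun δ => (⟨δ.1 ∩ My, Finset.mem_powerset.2 Finset.inter_subset_right⟩,
        ⟨δ.1 ∩ Mz, Finset.mem_powerset.2 Finset.inter_subset_right⟩)
      left_inv := fun p => by
        obtain ⟨⟨X, hX⟩, ⟨Y, hY⟩⟩ := p
        have hX' := Finset.mem_powerset.1 hX; have hY' := Finset.mem_powerset.1 hY
        refine Prod.ext (Subtype.ext ?_) (Subtype.ext ?_)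
        · show (X ∪ Y) ∩ My = X
          rw [Finset.union_inter_distrib_right, Finset.inter_eq_left.2 hX',
            Finset.disjoint_iff_inter_eq_empty.1 (Finset.disjoint_of_subset_left hY' hdM.symm), Finset.union_empty]
        · show (X ∪ Y) ∩ Mz = Y
          rw [Finset.union_inter_distrib_right, Finset.inter_eq_left.2 hY',
            Finset.disjoint_iff_inter_eq_empty.1 (Finset.disjoint_of_subset_left hX' hdM), Finset.empty_union]
      right_inv := fun δ => Subtype.ext (by
        show δ.1 ∩ My ∪ δ.1 ∩ Mz = δ.1
        rw [← Finset.inter_union_distrib_left, Finset.inter_eq_left.2 (Finset.mem_powerset.1 δ.2)]) }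
  have hφ : Monotone φ := fun p q hpq => show (φ p).1 ⊆ (φ q).1 from Finset.union_subset_union hpq.1 hpq.2
  have hMy' : insert s(uy, vy) My ⊆ B := Finset.insert_subset hy hMyB
  have hMz' : insert s(uz, vz) Mz ⊆ B' := Finset.insert_subset hz hMzB
  have hd' : ∀ p : ↥My.powerset × ↥Mz.powerset, realEnv (My ∪ Mz) (Cy ∪ Cz) c d s(uy, vy) s(uz, vz) (φ p) =
      ⟨⟨(Base.thetaPair (realBox My Cy c d s(uy, vy)) (realBox Mz Cz c d s(uz, vz)) p).d0.lam + (-(2 * (Fintype.card V : ℤ))),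
          (Base.thetaPair (realBox My Cy c d s(uy, vy)) (realBox Mz Cz c d s(uz, vz)) p).d0.k1,
          (Base.thetaPair (realBox My Cy c d s(uy, vy)) (realBox Mz Cz c d s(uz, vz)) p).d0.k2⟩,
        ⟨(Base.thetaPair (realBox My Cy c d s(uy, vy)) (realBox Mz Cz c d s(uz, vz)) p).dy.lam + (-(2 * (Fintype.card V : ℤ))),
          (Base.thetaPair (realBox My Cy c d s(uy, vy)) (realBox Mz Cz c d s(uz, vz)) p).dy.k1,
          (Base.thetaPair (realBox My Cy c d s(uy, vy)) (realBox Mz Cz c d s(uz, vz)) p).dy.k2⟩,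
        ⟨(Base.thetaPair (realBox My Cy c d s(uy, vy)) (realBox Mz Cz c d s(uz, vz)) p).dz.lam + (-(2 * (Fintype.card V : ℤ))),
          (Base.thetaPair (realBox My Cy c d s(uy, vy)) (realBox Mz Cz c d s(uz, vz)) p).dz.k1,
          (Base.thetaPair (realBox My Cy c d s(uy, vy)) (realBox Mz Cz c d s(uz, vz)) p).dz.k2⟩,
        ⟨(Base.thetaPair (realBox My Cy c d s(uy, vy)) (realBox Mz Cz c d s(uz, vz)) p).dyz.lam + (-(2 * (Fintype.card V : ℤ))),
          (Base.thetaPair (realBox My Cy c d s(uy, vy)) (realBox Mz Cz c d s(uz, vz)) p).dyz.k1,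
          (Base.thetaPair (realBox My Cy c d s(uy, vy)) (realBox Mz Cz c d s(uz, vz)) p).dyz.k2⟩⟩ := by
    rintro ⟨β, γ⟩
    have b0 : β.1 ⊆ insert s(uy, vy) My := (Finset.mem_powerset.1 β.2).trans (Finset.subset_insert _ _)
    have b1 : insert s(uy, vy) β.1 ⊆ insert s(uy, vy) My := Finset.insert_subset_insert _ (Finset.mem_powerset.1 β.2)
    have c0 : γ.1 ⊆ insert s(uz, vz) Mz := (Finset.mem_powerset.1 γ.2).trans (Finset.subset_insert _ _)
    have c1 : insert s(uz, vz) γ.1 ⊆ insert s(uz, vz) Mz := Finset.insert_subset_insert _ (Finset.mem_powerset.1 γ.2)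
    have e0 := PDat.eq_of_addLam (comb_realSDat hB hd hV hMy' hCyB hMz' hCzB b0 c0 (rfl : β.1 ∪ γ.1 = _))
    have ey := PDat.eq_of_addLam (comb_realSDat hB hd hV hMy' hCyB hMz' hCzB b1 c0 (Finset.insert_union _ _ _).symm)
    have ez := PDat.eq_of_addLam (comb_realSDat hB hd hV hMy' hCyB hMz' hCzB b0 c1 (Finset.union_insert _ _ _).symm)
    have eyz := PDat.eq_of_addLam (comb_realSDat hB hd hV hMy' hCyB hMz' hCzB b1 c1
      (by rw [Finset.insert_union, Finset.union_insert]))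
    show (⟨realPDat _ _ c d _ _ (β.1 ∪ γ.1), realPDat _ _ c d _ _ (insert s(uy, vy) (β.1 ∪ γ.1)),
      realPDat _ _ c d _ _ (insert s(uz, vz) (β.1 ∪ γ.1)), realPDat _ _ c d _ _ (insert s(uy, vy) (insert s(uz, vz) (β.1 ∪ γ.1)))⟩ : EDat) = _
    rw [e0, ey, ez, eyz]
    rfl
  refine ⟨?_, ?_, ?_, ?_, ?_⟩
  · exact fun H0 H1 m0 m1 n0 le J => transfer_Mt hφ (fun p J => ⟨(transfer_hs hd' p J).1, (transfer_hs hd' p J).2.1⟩)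
      (fun h0 h1 m0' m1' n0' le' J' => realPair_Mt_nonneg hB hB' hy hz hMy hCy hMz hCz m0' m1' n0' le' J') H0 H1 m0 m1 n0 le J
  · refine fun H0 H1 m0 m1 n0 le J => transfer_parE hφ hd' (fun h0 h1 m0' m1' n0' le' J' => ?_) H0 H1 m0 m1 n0 le J
    exact Base.thetaPair_parE_Mt_nonneg' _ _ (fun β => realBox_consistent hyM β) (fun γ => realBox_consistent hzM γ)
      (fun _ mh _ K => realBox_A1 hB hy hMy hCy mh K) (fun _ _ m0'' m1'' _ le'' K => realBox_A3n hB hy hMy hCy m0'' m1'' le'' K)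
      (fun _ _ m0'' m1'' _ le'' K => realBox_A4n hB hy hMy hCy m0'' m1'' le'' K)
      (fun _ mh _ K => realBox_A1 hB' hz hMz hCz mh K) (fun _ _ m0'' m1'' _ le'' K => realBox_A3n hB' hz hMz hCz m0'' m1'' le'' K)
      (fun _ _ m0'' m1'' _ le'' K => realBox_A4n hB' hz hMz hCz m0'' m1'' le'' K) m0' m1' n0' le' J'
  · exact fun h mh _ J => realEnv_andDel_nonneg hF hyF hzF hyz hME hCE hMC mh J
  · exact fun h mh _ J => realEnv_andCon_nonneg hF hyF hzF hyz hME hCE hMC mh J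
  · exact fun h0 h1 m0 m1 _ le J => realEnv_andFree_nonneg hF hyF hzF hyz hME hCE hMC m0 m1 le J

end Base

section Spine

variable {y z : Sym2 V} {M C : Finset (Sym2 V)} {a b : V}

/-- **The five facts hold for the real environment of every spine cell** (induction along the word). [cite: Grimmett2006, §3.8 Thm. (3.90) (pp. 61–62)]
[cite: Wagner2006, Thm. 5.8(d), §5.3] -/
theorem IsSpineCell.facts (h : IsSpineCell y z M C a b) :
    (∀ h0 h1 : ↥M.powerset → ℝ, Monotone h0 → Monotone h1 → (∀ γ, 0 ≤ h0 γ) → (∀ γ, h0 γ ≤ h1 γ) → ∀ J : ℤ,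
        0 ≤ Mt (realEnv M C a b y z) h0 h1 J)
      ∧ (∀ h0 h1 : Bool × ↥M.powerset → ℝ, Monotone h0 → Monotone h1 → (∀ p, 0 ≤ h0 p) → (∀ p, h0 p ≤ h1 p) → ∀ J : ℤ,
        0 ≤ Mt (parE (realEnv M C a b y z)) h0 h1 J)
      ∧ (∀ h : ↥M.powerset → ℝ, Monotone h → (∀ γ, 0 ≤ h γ) → ∀ J : ℤ, 0 ≤ ∑ γ, h γ * (realEnv M C a b y z γ).andDel J)
      ∧ (∀ h : ↥M.powerset → ℝ, Monotone h → (∀ γ, 0 ≤ h γ) → ∀ J : ℤ, 0 ≤ ∑ γ, h γ * (realEnv M C a b y z γ).andCon J)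
      ∧ (∀ h0 h1 : ↥M.powerset → ℝ, Monotone h0 → Monotone h1 → (∀ γ, 0 ≤ h0 γ) → (∀ γ, h0 γ ≤ h1 γ) → ∀ J : ℤ,
          0 ≤ ∑ γ, (h1 γ * (realEnv M C a b y z γ).andE1 J + h0 γ * (realEnv M C a b y z γ).andE2 J)) := by
  induction h with
  | base hB hB' hd hV hy hz hyB hzB hMy hCy hMz hCz hMCy hMCz =>
    subst hy; subst hz; exact realPairEnv_facts hB hB' hd hV hyB hzB hMy hCy hMz hCz hMCy hMCz
  | ser _ ha hab ham ih => exact realEnv_ser_facts ha hab ham ih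
  | par _ hg hab ih => exact realEnv_par_facts hg hab ih

omit [Fintype V] in
/-- The specials are off every spine cell, and the poles are distinct. [folklore] -/
theorem IsSpineCell.off (h : IsSpineCell y z M C a b) : y ∉ M ∧ z ∉ M ∧ y ∉ C ∧ z ∉ C ∧ y ≠ z ∧ a ≠ b := by
  induction h with
  | base hB hB' hd hV hy hz hyB hzB hMy hCy hMz hCz hMCy hMCz =>
    subst hy; subst hz
    have hMyB := hMy.trans (Finset.erase_subset _ _); have hMzB := hMz.trans (Finset.erase_subset _ _)
    have hCyB := hCy.trans (Finset.erase_subset _ _); have hCzB := hCz.trans (Finset.erase_subset _ _)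
    have hyB' := Finset.disjoint_left.1 hd hyB; have hzB0 := Finset.disjoint_right.1 hd hzB
    refine ⟨?_, ?_, ?_, ?_, fun h => hyB' (h ▸ hzB), hB.ne⟩ <;> rw [Finset.mem_union, not_or]
    · exact ⟨fun h => (Finset.mem_erase.1 (hMy h)).1 rfl, fun h => hyB' (hMzB h)⟩
    · exact ⟨fun h => hzB0 (hMyB h), fun h => (Finset.mem_erase.1 (hMz h)).1 rfl⟩
    · exact ⟨fun h => (Finset.mem_erase.1 (hCy h)).1 rfl, fun h => hyB' (hCzB h)⟩
    · exact ⟨fun h => hzB0 (hCyB h), fun h => (Finset.mem_erase.1 (hCz h)).1 rfl⟩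
  | ser _ ha hab ham ih =>
    obtain ⟨h1, h2, h3, h4, h5, _⟩ := ih
    refine ⟨?_, ?_, h3, h4, h5, hab⟩ <;> rw [Finset.mem_insert, not_or]
    · exact ⟨fun h => ha _ (Finset.mem_insert_self _ _) (h ▸ Sym2.mem_mk_left _ _), h1⟩
    · exact ⟨fun h => ha _ (Finset.mem_insert_of_mem (Finset.mem_insert_self _ _)) (h ▸ Sym2.mem_mk_left _ _), h2⟩
  | par _ hg hab ih =>
    obtain ⟨h1, h2, h3, h4, h5, _⟩ := ih
    refine ⟨?_, ?_, h3, h4, h5, hab⟩ <;> rw [Finset.mem_insert, not_or]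
    · exact ⟨fun h => hg (h ▸ Finset.mem_insert_self _ _), h1⟩
    · exact ⟨fun h => hg (h ▸ Finset.mem_insert_of_mem (Finset.mem_insert_self _ _)), h2⟩

/-- **THEOREM (★(Θ) for every spine word and all boxes: the `q`-free `maj₃` inequality on every spine host).**  Let `(M, C)` with poles
`a, b` be a spine cell over the special edges `y = u_y v_y`, `z = u_z v_z` (`IsSpineCell`: a theta pair of arbitrary two-terminal series–parallel
boxes followed by any word of series / parallel letters), and let the root `x = ab` be off the cell.  Then for the host `H = x ∥ 𝓔`, every
increasing `g` blind to `x, y, z` and every level `J`: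
`Σ_{γ ⊆ M ∪ {x,y,z} : level ≤ J} (maj₃(γ∪C) − maj₃(γᶜ∪C))·(g(γ∪C) − g(γᶜ∪C)) ≤ 0` — every coefficient, in the edge odds and in `q`, of
`Z_H(z,q)² Cov_{φ_{z,q}}(maj₃(ω_x,ω_y,ω_z), g)/(q − 1)` is nonnegative (Conjecture `C_∞⁺` at level 3 on these hosts; the word theorem ★(Θ) of memo
FROM-fk-2-g28 §4 for ALL words and ALL boxes, now a kernel theorem). [cite: Grimmett2006, §1.4 eq. (1.20) (p. 15); §3.8 Thm. (3.90) (pp. 61–62)]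
[cite: Wagner2006, Thm. 5.8(d), §5.3] -/
theorem maj3_levels_le_nonpos_of_isSpineCell {uy vy uz vz : V} (h : IsSpineCell s(uy, vy) s(uz, vz) M C a b)
    (hxM : s(a, b) ∉ M) (hxC : s(a, b) ∉ C) (hxy : s(a, b) ≠ s(uy, vy)) (hxz : s(a, b) ≠ s(uz, vz))
    {g : Finset (Sym2 V) → ℝ} (hgx : ∀ A : Finset (Sym2 V), g (insert s(a, b) A) = g A)
    (hgy : ∀ A : Finset (Sym2 V), g (insert s(uy, vy) A) = g A) (hgz : ∀ A : Finset (Sym2 V), g (insert s(uz, vz) A) = g A)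
    (hmono : ∀ ⦃X Y : Finset (Sym2 V)⦄, X ⊆ Y → g X ≤ g Y) (J : ℕ) :
    ∑ γ ∈ (insert s(a, b) (insert s(uy, vy) (insert s(uz, vz) M))).powerset with
        apExpC (insert s(a, b) (insert s(uy, vy) (insert s(uz, vz) M))) C γ ≤ J,
        ((((fun X : Finset (Sym2 V) => if (s(a, b) ∈ X ∧ s(uy, vy) ∈ X) ∨ (s(a, b) ∈ X ∧ s(uz, vz) ∈ X) ∨
              (s(uy, vy) ∈ X ∧ s(uz, vz) ∈ X) then (1 : ℝ) else 0) (γ ∪ C)) -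
            ((fun X : Finset (Sym2 V) => if (s(a, b) ∈ X ∧ s(uy, vy) ∈ X) ∨ (s(a, b) ∈ X ∧ s(uz, vz) ∈ X) ∨
              (s(uy, vy) ∈ X ∧ s(uz, vz) ∈ X) then (1 : ℝ) else 0)
                ((insert s(a, b) (insert s(uy, vy) (insert s(uz, vz) M))) \ γ ∪ C))) *
          (g (γ ∪ C) - g ((insert s(a, b) (insert s(uy, vy) (insert s(uz, vz) M))) \ γ ∪ C))) ≤ 0 := by
  obtain ⟨hyM, hzM, hyC, hzC, hyz, -⟩ := h.off
  exact maj3_levels_le_nonpos_of_rootFact hxM hyM hzM hxC hyC hzC hxy hxz hyz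
    (fun w mw nw J => h.facts.1 w w mw mw nw (fun _ => le_rfl) J) hgx hgy hgz hmono J

end Spine

end RootForm

end FK

end Summit.CriticalPhenomena.PercolationContinuityZ3.Theorems

end
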